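import Literature.Topology.FourManifolds.SlideCurvesK2a
import Literature.Topology.FourManifolds.SlideCurvesK2b
import HarnessLib

/-!
# The slid circle in the slab, III: the upper track piece, the agreements, and the glued height

Topic `Literature/Topology/FourManifolds`; fact seat `provefact-IsStrictHandleSlide.isSurgery`
(R. C. Kirby, *The Topology of 4-Manifolds*, LNM 1374 (1989), Ch. I §4, Fig. 4.2; remaining content:
the named fact (S) `Literature.Topology.FourManifolds.FramedLink.IsStrictHandleSlide.slideModel`).
(1) The upper track read forward: `yUp t = -Rup.y (-t)` has negative derivative and is strictly
decreasing on `[t_Lᵘ', t_Dᵘ' + η]` (`stub_track_up`, mirror of part I). (2) The three height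
formulas agree where they overlap: `Rlo.y = yP` just after the lower landing and `yUp = yP` just
before the upper landing (`y_lo_eq_yP`, `yUp_eq_yP`). (3) The glued height `Y₂` of the slid circle
along the knot parameter is strictly decreasing with negative derivative from the lower stub to
the upper stub (`Y₂_strictAnti`).

## References

* R. C. Kirby, *The Topology of 4-Manifolds*, LNM 1374, Springer (1989), Ch. I §4. [Kirby1989]
-/

open scoped Topology ContDiff
open Set Real Filter

noncomputable section

namespace Literature.Topology.FourManifolds

/-- `sliceY` is odd in the ordinate. [folklore] -/
theorem sliceY_neg_b (c r a b : ℝ) : sliceY c r a (-b) = -sliceY c r a b := by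
  simp only [sliceY]; ring

namespace BandCore

variable {A B : Knot} {avoid : Set (Metric.sphere (0 : EuclideanSpace ℝ (Fin 4)) 1)} {c : BandCore A B avoid}

namespace SlideChoice

variable {e : ℝ → ℝ} (P : c.SlideChoice e) (he : ContDiffOn ℝ ∞ e (Ioo (10⁻¹ : ℝ) (9 / 10)))

/-! ### The upper track and its stub (reflected parameter) -/

/-- `contDiffAt_y_tD_up` (auxiliary). [folklore] -/
theorem contDiffAt_y_tD_up : ContDiffAt ℝ ∞ (P.routeHypUp he).y P.du.tD := by
  apply (P.routeHypUp he).contDiffAt_y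
  · show P.du.H₁ P.du.tD ∈ Ioo (P.du.hr0 - 2 * P.μ) (P.du.hr1 + P.μ)
    have h := P.H₁_approach_up ⟨le_rfl, P.du.tD_lt_tL.le⟩
    exact ⟨by linarith [h.1, P.μ_pos], by linarith [h.2, P.μ_pos]⟩
  · show (P.routeHypUp he).Θ (P.du.H₁ P.du.tD) ∈ Ioo (-π) π
    rw [RouteHyp.H₁_tD (d := P.du)]
    show P.Θup (P.du.Hh P.du.tD) ∈ Ioo (-π) π
    rw [P.Θup_hDu']
    have h := P.θDu_mem; have := c.θlow_pos
    exact ⟨by linarith [h.1, pi_pos], by linarith [h.2]⟩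

/-- `exists_stub_up` (auxiliary). [folklore] -/
theorem exists_stub_up : ∃ η > 0, ∀ τ ∈ Icc (P.du.tD - η) P.du.tD,
    HasDerivAt (P.routeHypUp he).y (deriv (P.routeHypUp he).y τ) τ ∧ deriv (P.routeHypUp he).y τ < 0 := by
  set R := P.routeHypUp he
  have hcd := P.contDiffAt_y_tD_up he
  have hneg : deriv R.y P.du.tD < 0 := R.deriv_y_neg ⟨le_rfl, P.du.tD_lt_tL.le⟩
  have hcont : ContinuousAt (deriv R.y) P.du.tD := ContDiffAt.continuousAt_deriv_real hcd (by simp)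
  have hev1 : ∀ᶠ τ in 𝓝 P.du.tD, deriv R.y τ < 0 := hcont.eventually (gt_mem_nhds hneg)
  have hev2 : ∀ᶠ τ in 𝓝 P.du.tD, DifferentiableAt ℝ R.y τ := by
    have h2 : ContDiffAt ℝ 2 R.y P.du.tD := hcd.of_le (WithTop.coe_le_coe.2 le_top)
    exact (h2.eventually (by simp)).mono fun τ hτ ↦ hτ.differentiableAt (by simp)
  obtain ⟨η, hη, hball⟩ := Metric.eventually_nhds_iff.1 (hev1.and hev2)
  refine ⟨η / 2, by positivity, fun τ hτ ↦ ?_⟩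
  have hτb : dist τ P.du.tD < η := by rw [Real.dist_eq, abs_lt]; constructor <;> linarith [hτ.1, hτ.2]
  exact ⟨(hball hτb).2.hasDerivAt, (hball hτb).1⟩

/-- The upper landing/tip parameters read forward. [folklore] -/
def tDu' : ℝ := -P.du.tD

/-- `tLu'_lt_tDu'` (auxiliary). [folklore] -/
theorem tLu'_lt_tDu' : P.tLu' < P.tDu' := by rw [tLu', tDu']; linarith [P.du.tD_lt_tL]

/-- **The twisted height along the upper track read forward**, `-Rup.y (-t)`. [folklore] -/
def yUp (t : ℝ) : ℝ := -(P.routeHypUp he).y (-t)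

/-- **The upper track with its stub, forward**: for some `η > 0`, on `[t_Lᵘ', t_Dᵘ' + η]` the height
`yUp` has negative derivative and is strictly decreasing. [cite: Kirby1989, Ch. I §4] -/
theorem stub_track_up : ∃ η > 0, (∀ t ∈ Icc P.tLu' (P.tDu' + η),
    HasDerivAt (P.yUp he) (deriv (P.yUp he) t) t ∧ deriv (P.yUp he) t < 0) ∧
    StrictAntiOn (P.yUp he) (Icc P.tLu' (P.tDu' + η)) := by
  set R := P.routeHypUp he
  obtain ⟨η, hη, hstub⟩ := P.exists_stub_up he
  have hR : ∀ τ ∈ Icc (P.du.tD - η) P.du.tL, HasDerivAt R.y (deriv R.y τ) τ ∧ deriv R.y τ < 0 := by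
    intro τ hτ
    rcases le_total τ P.du.tD with h | h
    · exact hstub τ ⟨hτ.1, h⟩
    · exact ⟨(R.hasDerivAt_y ⟨h, hτ.2⟩).differentiableAt.hasDerivAt, R.deriv_y_neg ⟨h, hτ.2⟩⟩
  have hd : ∀ t ∈ Icc P.tLu' (P.tDu' + η), HasDerivAt (P.yUp he) (deriv (P.yUp he) t) t ∧ deriv (P.yUp he) t < 0 := by
    intro t ht
    have hm : -t ∈ Icc (P.du.tD - η) P.du.tL := ⟨by rw [tDu'] at ht; linarith [ht.2], by rw [tLu'] at ht; linarith [ht.1]⟩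
    obtain ⟨hda, hneg⟩ := hR (-t) hm
    have hc : HasDerivAt (P.yUp he) (-(deriv R.y (-t) * -1)) t := by
      have : P.yUp he = fun s ↦ -R.y (-s) := rfl
      rw [this]; exact (hda.comp t (hasDerivAt_neg t)).neg
    rw [hc.deriv]; exact ⟨hc, by nlinarith⟩
  exact ⟨η, hη, hd, (strictAntiOn_of_local_pieces fun s hs ↦ ⟨P.yUp he, _, EventuallyEq.rfl, hd s hs⟩).2⟩

/-! ### Agreement of the formulas after the lower landing and before the upper landing -/

/-- After the lower landing (still short of the far point) the lower route height is the far-side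
height. [folklore] -/
theorem y_lo_eq_yP {t : ℝ} (ht : t ∈ Icc P.dl.tL (c.tlo - c.epsLo)) (hθ : (P.routeHypLo he).θ t ∈ Ioo (-π) π) :
    (P.routeHypLo he).y t = P.yP t := by
  set R := P.routeHypLo he
  have hr : R.r t = 1 := by
    show 1 + (1 - P.dl.X₁ t) * e (P.dl.H₁ t) = 1
    rw [P.dl.X₁_of_tL_le ht.1]; ring
  have hθP : P.θP t = R.θ t := by rw [θP, if_pos ht.2]; rfl
  show R.r t * sin (twistAngle R.c (R.r t) (R.θ t)) = sliceY P.tw 1 (cos (P.θP t)) (sin (P.θP t))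
  rw [hθP, sliceY_cos_sin hθ, hr]; rfl

/-- Before the upper landing the forward upper route height is the far-side height. [folklore] -/
theorem yUp_eq_yP {t : ℝ} (ht : t ∈ Icc (c.thi + c.epsHi) P.tLu') (hθ : (P.routeHypUp he).θ (-t) ∈ Ioo (-π) π) :
    P.yUp he t = P.yP t := by
  set R := P.routeHypUp he
  have hε := c.epsLo_pos'; have hε' := c.epsHi_bounds.1
  obtain ⟨-, -, -, h34, -⟩ := c.marks_lt
  have hr : R.r (-t) = 1 := by
    show 1 + (1 - P.du.X₁ (-t)) * e (1 - P.du.H₁ (-t)) = 1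
    rw [P.du.X₁_of_tL_le (by rw [tLu'] at ht; linarith [ht.2])]; ring
  have hθP : P.θP t = 2 * π - R.θ (-t) := by
    rcases eq_or_lt_of_le ht.1 with h | h
    · rw [θP, if_neg (by linarith), if_pos h.symm.le, P.θPmid_eq_θPup ⟨by linarith, by linarith⟩, θPup]
      show 2 * π + c.ΘB (1 - P.du.H₁ (-t)) - P.φ = 2 * π - P.Θup (P.du.H₁ (-t))
      rw [Θup]; ring
    · rw [θP, if_neg (by linarith), if_neg (by linarith), θPup]
      show 2 * π + c.ΘB (1 - P.du.H₁ (-t)) - P.φ = 2 * π - P.Θup (P.du.H₁ (-t))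
      rw [Θup]; ring
  show -(R.r (-t) * sin (twistAngle R.c (R.r (-t)) (R.θ (-t)))) = sliceY P.tw 1 (cos (P.θP t)) (sin (P.θP t))
  rw [hθP, cos_two_pi_sub, sin_two_pi_sub, sliceY_neg_b, sliceY_cos_sin hθ, hr]; rfl

/-! ### The glued height of the slid circle -/

/-- **The twisted height of the slid circle along its parameter** (lower track with stub, far side,
upper track with stub). [folklore] -/
def Y₂ (t : ℝ) : ℝ := if t ≤ P.dl.tL then (P.routeHypLo he).y t else if t ≤ P.tLu' then P.yP t else P.yUp he t

/-- The lower route angle stays short of the far point just after the landing. [folklore] -/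
theorem eventually_θ_lo_mem : ∀ᶠ t in 𝓝 P.dl.tL, (P.routeHypLo he).θ t ∈ Ioo (-π) π := by
  set R := P.routeHypLo he
  have hc : ContinuousAt R.θ P.dl.tL := by
    have hH : P.dl.H₁ P.dl.tL ∈ Ioo R.w₁ R.w₂ := R.hwin _ ⟨P.dl.tD_lt_tL.le, le_rfl⟩
    have : R.θ = fun s ↦ R.Θ (P.dl.H₁ s) := rfl
    rw [this]
    exact ((R.Θ_smooth.continuousOn.continuousAt (Ioo_mem_nhds hH.1 hH.2)).comp P.dl.contDiff_H₁.continuous.continuousAt)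
  exact hc.eventually (isOpen_Ioo.mem_nhds (R.θ_mem_Ioo ⟨P.dl.tD_lt_tL.le, le_rfl⟩))

/-- `eventually_θ_up_mem` (auxiliary). [folklore] -/
theorem eventually_θ_up_mem : ∀ᶠ t in 𝓝 P.tLu', (P.routeHypUp he).θ (-t) ∈ Ioo (-π) π := by
  set R := P.routeHypUp he
  have hc : ContinuousAt (fun t ↦ R.θ (-t)) P.tLu' := by
    have hH : P.du.H₁ P.du.tL ∈ Ioo R.w₁ R.w₂ := R.hwin _ ⟨P.du.tD_lt_tL.le, le_rfl⟩
    have : (fun t ↦ R.θ (-t)) = fun s ↦ R.Θ (P.du.H₁ (-s)) := rfl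
    rw [this]
    refine (R.Θ_smooth.continuousOn.continuousAt (Ioo_mem_nhds ?_ ?_)).comp
      (P.du.contDiff_H₁.continuous.continuousAt.comp continuous_neg.continuousAt)
    · show R.w₁ < P.du.H₁ (-P.tLu'); rw [tLu', neg_neg]; exact hH.1
    · show P.du.H₁ (-P.tLu') < R.w₂; rw [tLu', neg_neg]; exact hH.2
  have hm : R.θ (-P.tLu') ∈ Ioo (-π) π := by rw [tLu', neg_neg]; exact R.θ_mem_Ioo ⟨P.du.tD_lt_tL.le, le_rfl⟩
  exact hc.eventually (isOpen_Ioo.mem_nhds hm)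

/-- **The slid circle's height is strictly decreasing across the slab**: for some `η > 0`, `Y₂`
has negative derivative and is strictly decreasing on `[t_D - η, t_Dᵘ' + η]`. [cite: Kirby1989, Ch. I §4] -/
theorem Y₂_strictAnti : ∃ η > 0, (∀ t ∈ Icc (P.dl.tD - η) (P.tDu' + η),
    HasDerivAt (P.Y₂ he) (deriv (P.Y₂ he) t) t ∧ deriv (P.Y₂ he) t < 0) ∧
    StrictAntiOn (P.Y₂ he) (Icc (P.dl.tD - η) (P.tDu' + η)) := by
  obtain ⟨η₁, hη₁, hlo, -⟩ := P.stub_track_lo he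
  obtain ⟨η₂, hη₂, hup, -⟩ := P.stub_track_up he
  have hP := (P.yP_strictAnti he).1
  have hε := c.epsLo_pos'; have hε' := c.epsHi_bounds.1
  obtain ⟨-, -, -, h34, -⟩ := c.marks_lt
  have htL := P.tL_mem; have htLu := P.tLu'_mem; have hlt := P.tL_lt_tLu'; have hlt2 := P.tLu'_lt_tDu'
  refine ⟨min η₁ η₂, lt_min hη₁ hη₂, ?_⟩
  have hm1 := min_le_left η₁ η₂; have hm2 := min_le_right η₁ η₂
  apply strictAntiOn_of_local_pieces
  intro t ht
  -- three regimes with local agreement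
  rcases lt_trichotomy t P.dl.tL with h1 | h1 | h1
  · -- strictly before the lower landing: `Y₂ = Rlo.y` near `t`
    obtain ⟨hd, hneg⟩ := hlo t ⟨by linarith [ht.1], h1.le⟩
    refine ⟨_, _, ?_, hd, hneg⟩
    filter_upwards [Iio_mem_nhds h1] with s hs
    show P.Y₂ he s = _; rw [Y₂, if_pos (le_of_lt hs)]
  · -- at the lower landing: `Y₂ = Rlo.y` on a neighbourhood (agreement just after)
    subst h1
    obtain ⟨hd, hneg⟩ := hlo P.dl.tL ⟨by linarith [P.dl.tD_lt_tL], le_rfl⟩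
    refine ⟨_, _, ?_, hd, hneg⟩
    filter_upwards [P.eventually_θ_lo_mem he, Iio_mem_nhds (show P.dl.tL < c.tlo - c.epsLo by linarith [htL.2])] with s hs hs2
    show P.Y₂ he s = _
    rw [Y₂]
    split_ifs with h2 h3
    · rfl
    · exact (P.y_lo_eq_yP he ⟨(lt_of_not_ge h2).le, (mem_Iio.1 hs2).le⟩ hs).symm
    · exfalso; exact h3 (by linarith [mem_Iio.1 hs2, htLu.1])
  rcases lt_trichotomy t P.tLu' with h2 | h2 | h2
  · -- strictly between the landings: `Y₂ = yP` near `t`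
    obtain ⟨hd, hneg⟩ := hP t ⟨h1.le, h2.le⟩
    refine ⟨_, _, ?_, hd, hneg⟩
    filter_upwards [Ioo_mem_nhds h1 h2] with s hs
    show P.Y₂ he s = _; rw [Y₂, if_neg (not_le.2 hs.1), if_pos hs.2.le]
  · -- at the upper landing: `Y₂ = yUp` on a neighbourhood (agreement just before)
    subst h2
    obtain ⟨hd, hneg⟩ := hup P.tLu' ⟨le_rfl, by linarith⟩
    refine ⟨_, _, ?_, hd, hneg⟩
    filter_upwards [P.eventually_θ_up_mem he, Ioi_mem_nhds (show c.thi + c.epsHi < P.tLu' by linarith [htLu.1])] with s hs hs2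
    show P.Y₂ he s = _
    rw [Y₂]
    split_ifs with h3 h4
    · exfalso; linarith [mem_Ioi.1 hs2, htL.2]
    · exact (P.yUp_eq_yP he ⟨(mem_Ioi.1 hs2).le, h4⟩ hs).symm
    · rfl
  · -- strictly after the upper landing: `Y₂ = yUp` near `t`
    obtain ⟨hd, hneg⟩ := hup t ⟨h2.le, by linarith [ht.2]⟩
    refine ⟨_, _, ?_, hd, hneg⟩
    filter_upwards [Ioi_mem_nhds h2] with s hs
    show P.Y₂ he s = _; rw [Y₂, if_neg (by linarith [mem_Ioi.1 hs]), if_neg (not_le.2 hs)]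

end SlideChoice

end BandCore

end Literature.Topology.FourManifolds
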